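import Summits.QuantumFields.YangMills.Theorems.MirrorModularBoostsHypercubicLimitPeelReflHermRP
import Summits.QuantumFields.YangMills.Theorems.LangevinControlUVOSLegsFromFemtoAndGapDefsR3
import Summits.QuantumFields.YangMills.Theorems.PencilRigidityNPointIsotropyUnorderedRPTransport
import HarnessLib

/-!
# Crux `HypercubicLimit` (stmt-QuantumFields-16154), line `peel-and-disseminate`: (R3a) reflection positivity of the one-field limits on positive-time off-diagonal tuples

Support file (c3 seat) proving the registered piece (R3a) `stub_rpPos` of the reflection leg (R) of the line: for
every `SoftData` witness with `PolyRenorm` whose tori obey `1 ≤ L_k` and `a_k⁻² ≤ L_k`, the one-field limit `S₁`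
is reflection positive on finite tuples of POSITIVE-TIME (`IsPositiveTimeMulti`, unordered) OFF-DIAGONAL test
functions (`RPPos S₁`, the E2 input of the landed continuum assembly `reflHalf_of_pieces`).

Route:
* §1 LATTICE (`rpBlock_rpPos`, `rpFam_rpPos`): the RP-adapted lattice family `rpFam` of the scheme
  (`MirrorModularBoostsHypercubicLimitPeelRpFamDefs.lean`) is EXACTLY positive on finite tuples of positive-time
  test functions for `0 ≤ β`, `1 ≤ L`, `0 < a` — the proof of the host block `rpBlock_reflectionPositive`
  (`PencilRigidityHypercubicLimitRpBlockReflectionPositive.lean`) re-run with `IsPositiveTimeMulti` in place of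
  `IsTimeOrdered`: the corner-reflection reindexing `rp_osForm_eq_integral` is abstract, and the only place the
  support enters is the `P ∪ M`-dependence of the lattice functional (`rp_dependsOn_posTime`, the positive-time
  variant of `rp_dependsOn`: a centre with positive time has corner time `≥ 1`, `rp_corner_pos`), after which
  `wilsonExpectation_oddReflectionPositive` applies.
* §2 LIMIT (`rpPos_of_torusBound`): `rpFam` converges to `S₁` on `⁰𝒮` (`tendsto_rpFam`, with `a_k → 0`, eventually
  `0 < a_k`, `0 ≤ β_k` from `GapData` (i)–(ii) and `β_k → ∞`, `0 ≤ c_k ≤ a_k^{-Q}` from `SoftData`/`PolyRenorm`);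
  the OS witnesses `H i j` of `ΘFᵢ* ⊗ Fⱼ` are `(osAdjoint (F i)).appendTensor (F j)`, off-diagonal for positive-time
  off-diagonal factors (`isOffDiagonal_osAdjoint_appendTensor`); non-negative reals are closed (`ge_of_tendsto`,
  `tendsto_nhds_unique`).

Refs: OsterwalderSeiler1978 §§2–3 (lattice RP); OsterwalderSchrader1973 §3 (E2); GlimmJaffe1987 §6.1;
`LangevinControlUVOSLegsFromFemtoAndGapDefsR3.lean` §4.3 (`RPPos`).
-/

set_option autoImplicit false
noncomputable section
open scoped SchwartzMap ENNReal ComplexConjugate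
open MeasureTheory Filter Topology
open Literature.MathematicalPhysics.AQFT Literature.MathematicalPhysics.QuantumLattice
open Literature.MathematicalPhysics.QuantumFieldTheory
open Literature.Probability.LatticeModels (box Site)
open Summit.QuantumFields.YangMills.Cruxes.HypercubicLimit.ConditionalMeanTelescoping
open Summit.QuantumFields.YangMills.Cruxes.OSLegsFromFemtoAndGap.DlrCollarTransfer (RPPos)
open Summit.QuantumFields.YangMills.Theorems.HypercubicLimit.Negative (torusPlaquette thetaZ)
open Summit.QuantumFields.YangMills.Theorems.NPointIsotropy.QuarterTurnCornerOperator.UnorderedRP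
  (isOffDiagonal_osAdjoint_appendTensor)

namespace Summit.QuantumFields.YangMills.Cruxes.HypercubicLimit.PeelAndDisseminate

/-! ## §1 Exact positivity of the RP-adapted lattice family on positive-time tuples -/

section Lattice

-- adapted from `rp_dependsOn` (`IsTimeOrdered` ↦ `IsPositiveTimeMulti`)
/-- **`P ∪ M`-dependence of the lattice functional of a positive-time test function**: terms whose centre string
is not time-positive vanish; plaquettes with corner time in `[1, L]` live on `P ∪ M`. -/
theorem rp_dependsOn_posTime {G : Type} [Group G] [TopologicalSpace G] (r : LatticeRep G) {L : ℕ}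
    [Fact (1 < 2 * L + 1)] {a : ℝ} (ha : 0 < a) (m : {q : Fin 4 × Fin 4 // q.1 < q.2} → ℝ) {n : ℕ}
    (F : 𝓢((Fin n → EuclideanSpace ℝ (Fin 4)), ℂ)) (hF : IsPositiveTimeMulti F) :
    DependsOn (fun U : GaugeConfig 4 (2 * L + 1) G =>
        ∑ q : Fin n → {q : Fin 4 × Fin 4 // q.1 < q.2},
          ∑ x ∈ Fintype.piFinset (fun k => if (q k).1.1 = 0 then box 4 L
              else (box 4 L).filter (fun y => 1 - (L : ℤ) ≤ y 0)),
            F (fun k => a • (siteToE (x k) + (2⁻¹ : ℝ) • (EuclideanSpace.single (q k).1.1 (1 : ℝ) +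
              EuclideanSpace.single (q k).1.2 (1 : ℝ) - EuclideanSpace.single 0 (1 : ℝ)))) *
              ((∏ k, (torusPlaquette r (2 * L + 1) (q k).1.1 (q k).1.2 (x k) U - m (q k)) : ℝ) : ℂ))
      ((WilsonOddRP.oPosEdges ∪ WilsonOddRP.oSharedEdges : Finset (Edge 4 (2 * L + 1))) :
        Set (Edge 4 (2 * L + 1))) := by
  intro U V hUV
  refine Finset.sum_congr rfl fun q _ => Finset.sum_congr rfl fun x hx =>
    mul_eq_mul_left_iff.2 (or_iff_not_imp_right.2 fun h0 => ?_)
  congr 1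
  refine Finset.prod_congr rfl fun k _ => ?_
  have h1 : 1 ≤ x k 0 :=
    rp_corner_pos ha (q k) (x k) ((hF (subset_tsupport _ (Function.mem_support.2 h0))) k)
  have h2 : x k 0 ≤ L := by
    have hk := Fintype.mem_piFinset.1 hx k
    split_ifs at hk
    exacts [((Literature.Probability.LatticeModels.mem_box.1 hk) 0).2,
      ((Literature.Probability.LatticeModels.mem_box.1 (Finset.mem_filter.1 hk).1) 0).2]
  rw [Theorems.HypercubicLimit.Negative.dependsOn_torusPlaquette r (2 * L + 1) _ _ (x k)
    fun e he => hUV e (rp_edges_subset (q k).2 h1 h2 he)]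

-- adapted from `rpBlock_reflectionPositive` (`IsReflectionPositive` ↦ `RPPos`)
/-- **Exact Osterwalder–Seiler positivity of the RP-adapted family on positive-time tuples.** For `β ≥ 0`,
`L ≥ 1`, `a > 0` and any centring `m`, the RP-adapted lattice family is EXACTLY positive on finite tuples of
positive-time test functions (`RPPos`): after the corner-reflection reindexing (`rp_osForm_eq_integral`) the E2 sum
is `∫ conj (C (Θ U)) · C U dμ` for a bounded measurable `C` living on `P ∪ M` (`rp_dependsOn_posTime`), and
`wilsonExpectation_oddReflectionPositive` applies. -/
theorem rpBlock_rpPos :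
    ∀ (G : Type) [Group G] [TopologicalSpace G] [IsTopologicalGroup G] [CompactSpace G]
      [MeasurableSpace G] [BorelSpace G] (r : LatticeRep G) (β : ℝ) (L : ℕ) (a lam : ℝ)
      (m : {q : Fin 4 × Fin 4 // q.1 < q.2} → ℝ), 0 ≤ β → 1 ≤ L → 0 < a →
      RPPos
        ((fun n => ∑ q : Fin n → {q : Fin 4 × Fin 4 // q.1 < q.2},
            ∑ x ∈ Fintype.piFinset (fun k => if (q k).1.1 = 0 then box 4 L
                else (box 4 L).filter (fun y => 1 - (L : ℤ) ≤ y 0)),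
              (((lam ^ n * ∫ U, ∏ k, (torusPlaquette r (2 * L + 1) (q k).1.1 (q k).1.2 (x k) U - m (q k))
                  ∂(wilsonMeasure r.ρ β : Measure (GaugeConfig 4 (2 * L + 1) G)) : ℝ) : ℂ)) •
                LabelledSchwingerFamily.evalAt (fun k => a • (siteToE (x k) +
                  (2⁻¹ : ℝ) • (EuclideanSpace.single (q k).1.1 (1 : ℝ) + EuclideanSpace.single (q k).1.2 (1 : ℝ)
                    - EuclideanSpace.single 0 (1 : ℝ))))) :
          SchwingerFamily (EuclideanSpace ℝ (Fin 4))) := by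
  intro G _ _ _ _ _ _ r β L a lam m hβ hL ha N deg F hF _hFo H hH
  simp only [_root_.sum_apply, _root_.smul_apply, LabelledSchwingerFamily.evalAt_apply, smul_eq_mul]
  haveI := isProbabilityMeasure_wilsonMeasure (d := 4) (L := 2 * L + 1) r.ρ r.continuous β
  haveI : Fact (1 < 2 * L + 1) := ⟨by omega⟩
  set D : {q : Fin 4 × Fin 4 // q.1 < q.2} → Finset (Fin 4 → ℤ) := fun q =>
    if q.1.1 = 0 then box 4 L else (box 4 L).filter (fun y => 1 - (L : ℤ) ≤ y 0)
  set T : {q : Fin 4 × Fin 4 // q.1 < q.2} → (Fin 4 → ℤ) → GaugeConfig 4 (2 * L + 1) G → ℝ :=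
    fun q y U => torusPlaquette r (2 * L + 1) q.1.1 q.1.2 y U - m q
  set pt : {q : Fin 4 × Fin 4 // q.1 < q.2} → (Fin 4 → ℤ) → EuclideanSpace ℝ (Fin 4) := fun q y =>
    a • (siteToE y + (2⁻¹ : ℝ) • (EuclideanSpace.single q.1.1 (1 : ℝ) +
      EuclideanSpace.single q.1.2 (1 : ℝ) - EuclideanSpace.single 0 (1 : ℝ)))
  have hTm : ∀ q y, Measurable (T q y) := fun q y =>
    (Theorems.HypercubicLimit.Negative.measurable_torusPlaquette r _ _ _ y).sub measurable_const
  have hTb : ∀ q y, ∃ C, ∀ U, |T q y U| ≤ C := fun q y => ⟨r.N + |m q|, fun U =>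
    (abs_sub _ _).trans (add_le_add (abs_plaquetteObs_le_holds (ρ := r.ρ) r.mem_unitary y q.1.1
      q.1.2 (torusLift (2 * L + 1) U)) le_rfl)⟩
  have key := rp_osForm_eq_integral (wilsonMeasure r.ρ β : Measure (GaugeConfig 4 (2 * L + 1) G))
    GaugeConfig.timeReflect D (fun q y => if q.1.1 = 0 then thetaZ y - Pi.single 0 1 else thetaZ y)
    (herm_corner_mem L) herm_corner_inv pt (herm_point_reflect a) T
    (fun q y U => congrArg (· - m q) (herm_torusPlaquette_corner r _ q y U).symm) hTm hTb lam deg F H hH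
  set C : GaugeConfig 4 (2 * L + 1) G → ℂ := fun U => ∑ j, ((lam ^ deg j : ℝ) : ℂ) *
    ∑ q : Fin (deg j) → {q : Fin 4 × Fin 4 // q.1 < q.2}, ∑ x ∈ Fintype.piFinset (fun k => D (q k)),
      F j (fun k => pt (q k) (x k)) * ((∏ k, T (q k) (x k) U : ℝ) : ℂ) with hC
  have hCm : Measurable C :=
    hC ▸ Finset.measurable_sum _ fun j _ => (rp_measurable_sum D T hTm _).const_mul _
  have hCb : ∃ B : ℝ, ∀ U, ‖C U‖ ≤ B := by
    choose B hB using fun j => rp_bounded_sum D T hTb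
      fun (q : Fin (deg j) → {q : Fin 4 × Fin 4 // q.1 < q.2}) x => F j fun k => pt (q k) (x k)
    refine ⟨∑ j, ‖((lam ^ deg j : ℝ) : ℂ)‖ * B j, fun U => ?_⟩
    rw [hC]
    exact (norm_sum_le _ _).trans (Finset.sum_le_sum fun j _ => (norm_mul_le _ _).trans
      (mul_le_mul_of_nonneg_left (hB j U) (norm_nonneg _)))
  have hCdep : DependsOn C ((WilsonOddRP.oPosEdges ∪ WilsonOddRP.oSharedEdges :
      Finset (Edge 4 (2 * L + 1))) : Set (Edge 4 (2 * L + 1))) := fun U V hUV => by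
    rw [hC]
    exact Finset.sum_congr rfl fun j _ =>
      congrArg (((lam ^ deg j : ℝ) : ℂ) * ·) (rp_dependsOn_posTime r ha m (F j) (hF j) hUV)
  have hpos := wilsonExpectation_oddReflectionPositive (d := 4) (L := 2 * L + 1) r.ρ ⟨L, rfl⟩
    (by omega) r.continuous hβ C hCm hCb hCdep
  have key' := key.trans (show _ = wilsonExpectation (d := 4) (L := 2 * L + 1) r.ρ β
    (fun U => conj (C U.timeReflect) * C U) from rfl)
  obtain ⟨h1, h2⟩ := Complex.nonneg_iff.1 hpos
  rw [← key'] at h1 h2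
  exact ⟨h1, h2.symm⟩

variable {G : Type} [Group G] [TopologicalSpace G] [IsTopologicalGroup G] [CompactSpace G]
  [MeasurableSpace G] [BorelSpace G]

/-- **The RP-adapted family of a scheme is EXACTLY positive on positive-time tuples** for `β ≥ 0`, `L ≥ 1`,
`a > 0` (`rpBlock_rpPos` at the torus-mean centring of `rpFam`). -/
theorem rpFam_rpPos (r : LatticeRep G) {β : ℝ} {L : ℕ} {a : ℝ} (lam : ℝ) (hβ : 0 ≤ β) (hL : 1 ≤ L)
    (ha : 0 < a) : RPPos (rpFam r β L a lam) :=
  rpBlock_rpPos G r β L a lam (fun q => wilsonTorusMean r.ρ β L (planeObs r q.1)) hβ hL ha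

end Lattice

/-! ## §2 Passage to the one-field limit -/

section Limit

variable {G : Type} [Group G] [TopologicalSpace G] [IsTopologicalGroup G] [CompactSpace G]
  [MeasurableSpace G] [BorelSpace G]

/-- **(R3a) with the torus lower bound explicit.**  For every `SoftData` witness with `PolyRenorm` whose tori obey
`1 ≤ L_k` and `a_k⁻² ≤ L_k`, the one-field limit `S₁` is reflection positive on finite tuples of positive-time
off-diagonal test functions: the RP-adapted family of the scheme is, eventually in `k`, exactly positive on such
tuples (`rpFam_rpPos`; `β_k ≥ 0` and `a_k = m(β_k) > 0` eventually by `GapData` (i) and `β_k → ∞`), it converges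
to `S₁` on `⁰𝒮` (`tendsto_rpFam`; `a_k → 0` by `GapData` (ii)), the OS witnesses `H i j = ΘFᵢ* ⊗ Fⱼ` lie in `⁰𝒮`
(`isOffDiagonal_osAdjoint_appendTensor`), and `{z | 0 ≤ re z, im z = 0}` is closed. -/
theorem rpPos_of_torusBound (r : LatticeRep G) {β₁ C₁ c₂ : ℝ} {m : ℝ → ℝ}
    (hgap : GapData G r β₁ C₁ c₂ m) {Λ : ℝ → ℕ → ℕ} {δ₀ : ℝ} {sch : SpeciesScheme (YMSpecies G)}
    {S₁ : SchwingerFamily (EuclideanSpace ℝ (Fin 4))}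
    {Spl : (n : ℕ) → (Fin n → Fin 4 × Fin 4) → (𝓢((Fin n → EuclideanSpace ℝ (Fin 4)), ℂ) →L[ℂ] ℂ)}
    (hD : SoftData r m δ₀ Λ sch S₁ Spl) (hP : PolyRenorm r sch) (hL1 : ∀ k, 1 ≤ sch.L k)
    (hL2 : ∀ k, (sch.a k)⁻¹ * (sch.a k)⁻¹ ≤ (sch.L k : ℝ)) : RPPos S₁ := by
  obtain ⟨hunits, hβ, -, -, hc, -, hSpl, -, hexp, hS0, hS1, ⟨K, γ, s, hK, hUB, -, -⟩, -, -⟩ := hD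
  obtain ⟨Q, hQ⟩ := hP
  have ha0 : Tendsto sch.a atTop (𝓝 0) := (hgap.2.1.comp hβ).congr fun k => (hunits k).symm
  have hapos : ∀ᶠ k in atTop, 0 < sch.a k :=
    (hβ.eventually_ge_atTop β₁).mono fun k hk => by rw [hunits k]; exact hgap.1 _ hk
  have hβ0 : ∀ᶠ k in atTop, 0 ≤ sch.β k := hβ.eventually_ge_atTop 0
  have hc0 : ∀ k, 0 ≤ sch.c r.curvature k := fun k => by
    rw [hc k]; exact inv_nonneg.2 (Real.sqrt_nonneg _)
  have hconv := tendsto_rpFam r sch S₁ Spl hK ha0 hapos (Eventually.of_forall hL2) hc0 hQ hSpl hexp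
    hS0 hS1 hUB
  intro N deg F hF hFo H hH
  -- the witnesses are the OS tensors, hence off-diagonal
  have hHeq : ∀ i j, H i j = (osAdjoint (F i)).appendTensor (F j) := fun i j => by
    ext x; rw [hH i j x, SchwartzMap.appendTensor_apply]
  have hHoff : ∀ i j, IsOffDiagonal (H i j) := fun i j => by
    rw [hHeq i j]; exact isOffDiagonal_osAdjoint_appendTensor (hF i) (hFo i) (hF j) (hFo j)
  -- the lattice OS forms converge to the OS form of the limit
  set zk : ℕ → ℂ := fun k => ∑ i, ∑ j,
    rpFam r (sch.β k) (sch.L k) (sch.a k) (sch.c r.curvature k * sch.a k ^ 4) (deg i + deg j) (H i j)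
    with hzk
  have hz : Tendsto zk atTop (𝓝 (∑ i, ∑ j, S₁ (deg i + deg j) (H i j))) :=
    tendsto_finsetSum _ fun i _ => tendsto_finsetSum _ fun j _ => hconv _ _ (hHoff i j)
  -- and are eventually non-negative reals
  have hp : ∀ᶠ k in atTop, 0 ≤ (zk k).re ∧ (zk k).im = 0 :=
    (hapos.and hβ0).mono fun k hk => rpFam_rpPos r _ hk.2 (hL1 k) hk.1 N deg F hF hFo H hH
  have hre := (Complex.continuous_re.tendsto _).comp hz
  have him := (Complex.continuous_im.tendsto _).comp hz
  exact ⟨ge_of_tendsto hre (hp.mono fun k hk => hk.1),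
    tendsto_nhds_unique him (tendsto_const_nhds.congr' (hp.mono fun k hk => hk.2.symm))⟩

end Limit

/-- **(R3a) Reflection positivity of the one-field limits of the host closure on positive-time off-diagonal
tuples.**  For every `(G, r)` with gap data, every `SoftData` witness with `PolyRenorm` whose tori obey `1 ≤ L_k`
and `a_k⁻² ≤ L_k` has a one-field limit `S₁` with `RPPos S₁` (`rpPos_of_torusBound`). -/
theorem stub_rpPos :
    ∀ (G : Type) [Group G] [TopologicalSpace G] [IsTopologicalGroup G] [CompactSpace G]
      [MeasurableSpace G] [BorelSpace G] (r : LatticeRep G) (β₁ C₁ c₂ : ℝ) (m : ℝ → ℝ), GapData G r β₁ C₁ c₂ m →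
      ∀ (δ₀ : ℝ) (Λ : ℝ → ℕ → ℕ) (sch : SpeciesScheme (YMSpecies G)) (S₁ : SchwingerFamily (EuclideanSpace ℝ (Fin 4)))
        (Spl : (n : ℕ) → (Fin n → Fin 4 × Fin 4) → (𝓢((Fin n → (EuclideanSpace ℝ (Fin 4))), ℂ) →L[ℂ] ℂ)),
        SoftData r m δ₀ Λ sch S₁ Spl → PolyRenorm r sch →
        (∀ k, 1 ≤ sch.L k) → (∀ k, (sch.a k)⁻¹ * (sch.a k)⁻¹ ≤ (sch.L k : ℝ)) → RPPos S₁ := by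
  intro G _ _ _ _ _ _ r β₁ C₁ c₂ m hgap δ₀ Λ sch S₁ Spl hD hP hL1 hL2
  exact rpPos_of_torusBound r hgap hD hP hL1 hL2

end Summit.QuantumFields.YangMills.Cruxes.HypercubicLimit.PeelAndDisseminate

end
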